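import Literature.Analysis.FluidPDE.FluidComputer.ThresholdLevelTableX
import HarnessLib

/-!
# Kernel run of the level-table checker over the WIDER gate-data box (all seven data within 1/300), chunks 28 … 31 (bp3 gen 13, layer 4: robustness variant X)

HONEST FRAMING: low prior, high value-of-information experiment on Tao's machine paradigm; NOT a
claim that NS blows up.

Four kernel evaluations (`decide +kernel`; no `native_decide`, no extra axioms) of `runSteps`
with the interval gate data `GIx` (all seven data within relative `1/300`, `δ ∈ [0, (1 + 1/300) δ₀]`),
25 steps each, from `Bx28` to `Bx32`.
-/

namespace Literature.Analysis.FluidPDE.FluidComputer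

namespace ThresholdLevelTable

set_option maxHeartbeats 10000000 in
set_option maxRecDepth 200000 in
/-- Chunk 28 of the wider-data-box table run (steps 700 … 724). [folklore] -/
theorem runX28 : runSteps 60 12 3 GIx RbIt Bx28 chunk28 73345994452495776 = some Bx29 := by
  decide +kernel

set_option maxHeartbeats 10000000 in
set_option maxRecDepth 200000 in
/-- Chunk 29 of the wider-data-box table run (steps 725 … 749). [folklore] -/
theorem runX29 : runSteps 60 12 3 GIx RbIt Bx29 chunk29 87293743852046672 = some Bx30 := by
  decide +kernel

set_option maxHeartbeats 10000000 in
set_option maxRecDepth 200000 in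
/-- Chunk 30 of the wider-data-box table run (steps 750 … 774). [folklore] -/
theorem runX30 : runSteps 60 12 3 GIx RbIt Bx30 chunk30 103893849590411248 = some Bx31 := by
  decide +kernel

set_option maxHeartbeats 10000000 in
set_option maxRecDepth 200000 in
/-- Chunk 31 of the wider-data-box table run (steps 775 … 799). [folklore] -/
theorem runX31 : runSteps 60 12 3 GIx RbIt Bx31 chunk31 123650693697013712 = some Bx32 := by
  decide +kernel

end ThresholdLevelTable

end Literature.Analysis.FluidPDE.FluidComputer
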